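/-
Width seat `ym-line-cbag-p1-w3` (prover-ym-line-cbag-p1-w3-g2-0), route `ColdBoxAllGroups`, crux `BulkAllGroups`
(stmt-QuantumFields-22255), line `dlr-chessboard-G` (lead `ym-line-cbag-p2`, skeleton `Cruxes/BulkAllGroups/Lines/birth.lean` v4):
the DATUM PACKAGE, eventually in `β`, for every compact gauge group — G-port of `…BulkDominatesColdBoxWDatumCompetitorEventually` +
`…BulkDominatesColdBoxWDatumPackage`.
-/
import Summits.QuantumFields.YangMills.Theorems.ColdBoxAllGroupsBulkAllGroupsDatumCompetitorG
import Summits.QuantumFields.YangMills.Theorems.WeakCouplingRatesBulkDominatesColdBoxWDatumCompetitorEventually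
import Summits.QuantumFields.YangMills.Theorems.WeakCouplingRatesColdBoxExponents
import Summits.QuantumFields.YangMills.Theorems.WeakCouplingRatesBulkDominatesColdBoxWDatumShiftIntegral

/-!
# Crux `BulkAllGroups` (stmt-QuantumFields-22255), interfaces `KernelMeanExpansionG` / `KernelCovExpansionG`: the DATUM PACKAGE of a
# crude-good datum in the exponential chart, eventually in `β`, every compact `G` presented in `U(N)`

G-port of `Theorems/WeakCouplingRatesBulkDominatesColdBoxWDatumCompetitorEventually.lean` + `…DatumPackage.lean` (`SU(2)`: gnomonic chart,
constants `278400`, `16`).  For a faithful continuous unitary `ρ : G →* U(N)` (`N ≥ 1`), exponents `0 < θ`, `0 ≤ δ` with `9θ + δ < 1/2`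
(the window of the `SU(2)` proof; `δ = θ/5` in the line's family):

* `sqrt_sixteen_mul`, `smallLinkRadiusG_le` — the small-link radius of the competitor (`…DatumCompetitorG`) is
  `m₀ ≤ 3600·√N·H³·β^{δ−1/2}` (`H ≥ 1`, `β > 0`), hence `≤ 28800·√N·β^{3θ+δ−1/2}` at `H = ⌈β^θ⌉ ≤ 2β^θ`;
* **`exists_datum_chartCoords_energy_eventuallyG`** — there are constants `Ca, CE > 0` and `β₀` such that for every `β ≥ β₀` and every datum
  `ω` crude-good at scale `β^{2δ−1}` for the box `H = ⌈β^θ⌉` (`CrudeGoodG ρ β δ H ω`) there are a gauge `g` and exponential coordinates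
  `a : edges → ℝ^D` (`D = dimE ρ`) of the forest-gauged truncated gauge copy `W = forestFix H (glueWith E ((ω^g)|_E) 1)`,
  `E = boxEdgesAt dirCorner (2H+3)` — the configuration the lead's kernel transport `integral_boxKernelG_eq_trunc_gauge` (+ forest gauge) hands to
  the one-scale representation — with, on ALL of `ℤ⁴`:
  (1) `W e = expChart ρ (a e)`; (2) `‖a e‖ ≤ Ca·β^{3θ+δ−1/2}` (so `‖a e‖² ≤ Ca²·β^{6θ+2δ−1}`); (3) `a e = 0` wherever `W e = 1`, in particular
  on the temporal forest `{(x, e₀) : x interior}` and off `E`; (4) the energy clause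
  `Σ_c M_{a_c}(a_c|_free) ≤ CE·(2H+3)⁴·β^{2δ−1}` for the `D` one-colour pinned Maxwell forms of the enlarged box
  (`formM (· ∉ dirFreeEdges H) dirCorner (2H+3)`), datum AND competitor being the colour components of `a`
  (eventually `m₀ ≤ r₁(ρ)` — the operator-norm chart radius `exists_expChartRadius_opDist1` — and `2√N m₀ ≤ 1/4`, and
  `380(2√N m₀)³ ≤ β^{2δ−1}` because `9θ + δ < 1/2`; `#P ≤ 6(2H+3)⁴`; here `Ca = 57600·N`, `CE = 18`);
* **`exists_datum_packageG`** — the same in the literal `∃ ϑ, ∃ s` shape of the energy clause of `KernelMeanExpansionG` / `KernelCovExpansionG`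
  (`Theorems/ColdBoxAllGroupsDefs.lean`): colour-major datum `ϑ c e = (a e)_c`, competitor `s c = ϑ c|_free`, together with (1)–(3);
  `sum_formM_smul_chartCoords` — the energy clause for the rescaled datum `κ·ϑ` (e.g. `κ = 1/√2`, the Dirichlet-unit convention in which
  `β·cost ≈ ½|circ t|²`, `t = √β·a = √(2β)·(a/√2)`) is `κ²` times (4) (`formM_smul`, G-free).

No new definition; standard axioms.  NOT a claim about the mass gap; the Yang–Mills mass gap is NOT proved by any of this (rung-level support
of R2xi-G `XiPow`, RECORD label).
-/

set_option autoImplicit false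

noncomputable section

open Finset Filter Topology
open scoped Matrix.Norms.L2Operator
open Literature.Probability.LatticeModels Literature.MathematicalPhysics Literature.MathematicalPhysics.QuantumLattice
open Literature.MathematicalPhysics.QuantumFieldTheory Literature.MathematicalPhysics.QuantumFieldTheory.AxialGauge
open Literature.MathematicalPhysics.QuantumFieldTheory.LatticeMaxwell
open Literature.MathematicalPhysics.QuantumFieldTheory.Balaban1983to89 Literature.MathematicalPhysics.QuantumFieldTheory.Balaban1983to89.UnitaryModel
open Summit.QuantumFields.YangMills.Theorems.WeakCouplingRates
open Summit.QuantumFields.YangMills.Theorems.FreeEnergyLogCoefficient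

namespace Summit.QuantumFields.YangMills.Theorems.ColdBoxAllGroups

/-! ## The small-link radius along the family -/

/-- `√(2·(8N r²)) = 4√N·r` for `r ≥ 0`. -/
theorem sqrt_sixteen_mul (N : ℕ) {r : ℝ} (hr : 0 ≤ r) : Real.sqrt (2 * (8 * N * r ^ 2)) = 4 * Real.sqrt N * r := by
  have h : 2 * (8 * (N : ℝ) * r ^ 2) = (4 * Real.sqrt N * r) ^ 2 := by
    rw [mul_pow, mul_pow, Real.sq_sqrt (Nat.cast_nonneg N)]; ring
  rw [h, Real.sqrt_sq (by positivity)]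

/-- **The small-link radius is at most `3600·√N·H³·β^{δ−1/2}`** for `H ≥ 1`, `β > 0`, `N ≥ 1`
(`r₀ = 4(2H+3)√(2β^{2δ−1}) ≤ 30Hβ^{δ−1/2}`, `√(16N r₀²) + 4r₀ ≤ 8√N r₀`, `12H²+2H+1 ≤ 15H²`). -/
theorem smallLinkRadiusG_le {N : ℕ} [NeZero N] {H : ℕ} (hH : 1 ≤ H) {β δ : ℝ} (hβ : 0 < β) :
    (12 * (H : ℝ) ^ 2 + 2 * H + 1) *
        (Real.sqrt (2 * (8 * N * (4 * (2 * H + 3 : ℕ) * Real.sqrt (2 * β ^ (2 * δ - 1))) ^ 2)) +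
          4 * (4 * (2 * H + 3 : ℕ) * Real.sqrt (2 * β ^ (2 * δ - 1)))) ≤
      3600 * Real.sqrt N * (H : ℝ) ^ 3 * β ^ (δ - 1 / 2) := by
  have hH1 : (1 : ℝ) ≤ H := by exact_mod_cast hH
  have hN1 : (1 : ℝ) ≤ Real.sqrt N := by
    rw [Real.le_sqrt' one_pos, one_pow]; exact_mod_cast Nat.pos_of_ne_zero (NeZero.ne N)
  have hpow : 0 < β ^ (δ - 1 / 2) := Real.rpow_pos_of_pos hβ _
  have hsq : Real.sqrt (2 * β ^ (2 * δ - 1)) = Real.sqrt 2 * β ^ (δ - 1 / 2) := by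
    have : β ^ (2 * δ - 1) = (β ^ (δ - 1 / 2)) ^ 2 := by
      rw [← Real.rpow_natCast, ← Real.rpow_mul hβ.le]; norm_num; ring_nf
    rw [this, Real.sqrt_mul (by norm_num : (0 : ℝ) ≤ 2), Real.sqrt_sq hpow.le]
  set r₀ : ℝ := 4 * (2 * H + 3 : ℕ) * Real.sqrt (2 * β ^ (2 * δ - 1)) with hr₀
  have hr₀0 : 0 ≤ r₀ := by rw [hr₀]; positivity
  have h2 : Real.sqrt 2 ≤ 3 / 2 := by rw [Real.sqrt_le_left (by norm_num)]; norm_num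
  have hr₀le : r₀ ≤ 30 * (H : ℝ) * β ^ (δ - 1 / 2) := by
    rw [hr₀, hsq]; push_cast
    have : (4 * (2 * (H : ℝ) + 3)) * (Real.sqrt 2 * β ^ (δ - 1 / 2)) ≤ (4 * (5 * (H : ℝ))) * (3 / 2 * β ^ (δ - 1 / 2)) := by
      gcongr; linarith
    linarith
  rw [sqrt_sixteen_mul N hr₀0]
  clear_value r₀
  have hquad : 12 * (H : ℝ) ^ 2 + 2 * H + 1 ≤ 15 * (H : ℝ) ^ 2 := by nlinarith
  have hlin : 4 * Real.sqrt N * r₀ + 4 * r₀ ≤ 8 * Real.sqrt N * r₀ := by nlinarith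
  calc (12 * (H : ℝ) ^ 2 + 2 * H + 1) * (4 * Real.sqrt N * r₀ + 4 * r₀)
      ≤ (15 * (H : ℝ) ^ 2) * (8 * Real.sqrt N * r₀) := mul_le_mul hquad hlin (by positivity) (by positivity)
    _ ≤ (15 * (H : ℝ) ^ 2) * (8 * Real.sqrt N * (30 * (H : ℝ) * β ^ (δ - 1 / 2))) := by gcongr
    _ = 3600 * Real.sqrt N * (H : ℝ) ^ 3 * β ^ (δ - 1 / 2) := by ring

/-! ## The datum package, eventually in `β` -/

variable {N : ℕ} [NeZero N] {G : Type*} [Group G] [TopologicalSpace G] [CompactSpace G] [MeasurableSpace G]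
variable (ρ : G →* Matrix (Fin N) (Fin N) ℂ)

/-- **The datum package, eventually in `β`, every compact `G` presented in `U(N)`.**  See the module docstring: for `0 < θ`, `0 ≤ δ`,
`9θ + δ < 1/2` there are `Ca, CE > 0` and `β₀` such that for `β ≥ β₀`, `H = ⌈β^θ⌉`, every crude-good `ω` admits a gauge `g` and exponential
coordinates `a` of `W = forestFix H (glueWith E ((ω^g)|_E) 1)` with (1) `W e = expChart ρ (a e)` for all `e`; (2) `‖a e‖ ≤ Ca·β^{3θ+δ−1/2}`
for all `e`; (3) `a e = 0` wherever `W e = 1`; (3') `a (x, e₀) = 0` on the temporal forest; (4) `Σ_c M_{a_c}(a_c|_free) ≤ CE(2H+3)⁴β^{2δ−1}`. -/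
theorem exists_datum_chartCoords_energy_eventuallyG (hρ : Continuous ρ) (hinj : Function.Injective ρ)
    (hρu : ∀ g, ρ g ∈ Matrix.unitaryGroup (Fin N) ℂ) {θ δ : ℝ} (hθ : 0 < θ) (hδ : 0 ≤ δ) (hwin : 9 * θ + δ < 1 / 2) :
    ∃ Ca CE : ℝ, 0 < Ca ∧ 0 < CE ∧ ∃ β₀ : ℝ, ∀ β : ℝ, β₀ ≤ β → ∀ ω : LGConfig 4 G, CrudeGoodG ρ β δ ⌈β ^ θ⌉₊ ω →
      ∃ (g : Site 4 → G) (a : Literature.MathematicalPhysics.QuantumLattice.ZdEdge 4 → EuclideanSpace ℝ (Fin (dimE ρ))),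
        (∀ e, forestFix ⌈β ^ θ⌉₊ (glueWith (boxEdgesAt dirCorner (2 * ⌈β ^ θ⌉₊ + 3))
            (fun e' : ↥(boxEdgesAt dirCorner (2 * ⌈β ^ θ⌉₊ + 3)) => gaugeTransformZd g ω e'.1) (fun _ => 1)) e = expChart ρ (a e)) ∧
        (∀ e, ‖a e‖ ≤ Ca * β ^ (3 * θ + δ - 1 / 2)) ∧
        (∀ e, forestFix ⌈β ^ θ⌉₊ (glueWith (boxEdgesAt dirCorner (2 * ⌈β ^ θ⌉₊ + 3))
            (fun e' : ↥(boxEdgesAt dirCorner (2 * ⌈β ^ θ⌉₊ + 3)) => gaugeTransformZd g ω e'.1) (fun _ => 1)) e = 1 → a e = 0) ∧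
        (∀ x : Site 4, (∀ k : Fin 4, 1 ≤ x k ∧ x k + 1 ≤ 2 * (⌈β ^ θ⌉₊ : ℤ)) → a (x, 0) = 0) ∧
        ∑ c : Fin (dimE ρ), formM (fun e => e ∉ dirFreeEdges ⌈β ^ θ⌉₊) dirCorner (2 * ⌈β ^ θ⌉₊ + 3) (fun e => a e c)
            (fun e' : DirFree ⌈β ^ θ⌉₊ => a e'.1.1 c) ≤
          CE * (2 * (⌈β ^ θ⌉₊ : ℝ) + 3) ^ 4 * β ^ (2 * δ - 1) := by
  obtain ⟨r₁, hr₁, hchart⟩ := exists_expChartRadius_opDist1 ρ hρ hinj hρu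
  -- constants
  set K₁ : ℝ := 28800 * Real.sqrt N with hK₁
  set Ca : ℝ := 2 * Real.sqrt N * K₁ with hCa
  have hN1 : (1 : ℝ) ≤ Real.sqrt N := by
    rw [Real.le_sqrt' one_pos, one_pow]; exact_mod_cast Nat.pos_of_ne_zero (NeZero.ne N)
  have hK₁pos : 0 < K₁ := by rw [hK₁]; positivity
  have hCapos : 0 < Ca := by rw [hCa]; positivity
  have he1 : 0 < 1 / 2 - 3 * θ - δ := by linarith
  have he2 : 0 < 1 / 2 - 9 * θ - δ := by linarith
  -- eventually: `K₁ β^{3θ+δ−1/2} ≤ r₁`, `Ca β^{3θ+δ−1/2} ≤ 1/4`, `380 Ca³ β^{9θ+δ−1/2} ≤ 1`, `β ≥ 1`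
  have hT1 : Tendsto (fun β : ℝ => K₁ * β ^ (-(1 / 2 - 3 * θ - δ))) atTop (𝓝 0) := tendsto_const_mul_rpow_of_neg K₁ he1
  have hT2 : Tendsto (fun β : ℝ => Ca * β ^ (-(1 / 2 - 3 * θ - δ))) atTop (𝓝 0) := tendsto_const_mul_rpow_of_neg Ca he1
  have hT3 : Tendsto (fun β : ℝ => 380 * Ca ^ 3 * β ^ (-(1 / 2 - 9 * θ - δ))) atTop (𝓝 0) :=
    tendsto_const_mul_rpow_of_neg (380 * Ca ^ 3) he2
  have hev : ∀ᶠ β : ℝ in atTop, 1 ≤ β ∧ K₁ * β ^ (3 * θ + δ - 1 / 2) ≤ r₁ ∧ Ca * β ^ (3 * θ + δ - 1 / 2) ≤ 1 / 4 ∧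
      380 * Ca ^ 3 * β ^ (9 * θ + δ - 1 / 2) ≤ 1 := by
    filter_upwards [eventually_ge_atTop (1 : ℝ), hT1.eventually (Iic_mem_nhds hr₁),
      hT2.eventually (Iic_mem_nhds (by norm_num : (0 : ℝ) < 1 / 4)), hT3.eventually (Iic_mem_nhds one_pos)] with β hβ1 h1 h2 h3
    refine ⟨hβ1, ?_, ?_, ?_⟩
    · rw [show 3 * θ + δ - 1 / 2 = -(1 / 2 - 3 * θ - δ) by ring]; exact h1
    · rw [show 3 * θ + δ - 1 / 2 = -(1 / 2 - 3 * θ - δ) by ring]; exact h2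
    · rw [show 9 * θ + δ - 1 / 2 = -(1 / 2 - 9 * θ - δ) by ring]; exact h3
  obtain ⟨β₀, hβ₀⟩ := Filter.eventually_atTop.1 hev
  refine ⟨Ca, 18, hCapos, by norm_num, β₀, fun β hβ ω hω => ?_⟩
  obtain ⟨hβ1, hA, hB, hC⟩ := hβ₀ β hβ
  have hβ0 : 0 < β := by linarith
  set H : ℕ := ⌈β ^ θ⌉₊ with hHdef
  obtain ⟨hH1, hH2⟩ := one_le_ceil_rpow_and_le hβ1 hθ.le
  rw [← hHdef] at hH1 hH2
  have hH : 1 ≤ H := by exact_mod_cast hH1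
  -- the small-link radius along the family
  set m₀ : ℝ := (12 * (H : ℝ) ^ 2 + 2 * H + 1) *
      (Real.sqrt (2 * (8 * N * (4 * (2 * H + 3 : ℕ) * Real.sqrt (2 * β ^ (2 * δ - 1))) ^ 2)) +
        4 * (4 * (2 * H + 3 : ℕ) * Real.sqrt (2 * β ^ (2 * δ - 1)))) with hm₀
  have hm₀0 : 0 ≤ m₀ := by rw [hm₀]; positivity
  have hH3 : (H : ℝ) ^ 3 ≤ 8 * β ^ (3 * θ) := by
    have h := pow_le_pow_left₀ (by linarith : (0 : ℝ) ≤ H) hH2 3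
    have e : (2 * β ^ θ) ^ 3 = 8 * β ^ (3 * θ) := by
      rw [mul_pow, show (3 : ℝ) * θ = θ * ((3 : ℕ) : ℝ) by push_cast; ring, Real.rpow_mul_natCast hβ0.le]; norm_num
    rwa [e] at h
  have hm₀le : m₀ ≤ K₁ * β ^ (3 * θ + δ - 1 / 2) := by
    have h1 : m₀ ≤ 3600 * Real.sqrt N * (H : ℝ) ^ 3 * β ^ (δ - 1 / 2) := smallLinkRadiusG_le hH hβ0
    have hpos : 0 ≤ β ^ (δ - 1 / 2) := Real.rpow_nonneg hβ0.le _
    have h2 : 3600 * Real.sqrt N * (H : ℝ) ^ 3 * β ^ (δ - 1 / 2) ≤ 3600 * Real.sqrt N * (8 * β ^ (3 * θ)) * β ^ (δ - 1 / 2) := by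
      gcongr
    have e : 3600 * Real.sqrt N * (8 * β ^ (3 * θ)) * β ^ (δ - 1 / 2) = K₁ * β ^ (3 * θ + δ - 1 / 2) := by
      rw [hK₁, show 3 * θ + δ - 1 / 2 = 3 * θ + (δ - 1 / 2) by ring, Real.rpow_add hβ0]; ring
    linarith
  have hmle : 2 * Real.sqrt N * m₀ ≤ Ca * β ^ (3 * θ + δ - 1 / 2) := by
    have := mul_le_mul_of_nonneg_left hm₀le (by positivity : (0 : ℝ) ≤ 2 * Real.sqrt N)
    rw [hCa]; linarith
  -- the competitor
  obtain ⟨g, a, hW, han, ha0, hE⟩ :=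
    exists_datum_chartCoords_energy_leG ρ hρu hρ hinj hH hchart hω (hm₀le.trans hA) (hmle.trans hB)
  refine ⟨g, a, hW, fun e => (han e).trans hmle, ha0, fun x hx => ha0 _ (forestFix_forest _ hx), ?_⟩
  -- energy: `380 (2√N m₀)³ ≤ β^{2δ−1}` and `#P ≤ 6(2H+3)⁴`
  have hP := card_plaquettesIn_enlarged_le H
  have hβpow : 0 < β ^ (2 * δ - 1) := Real.rpow_pos_of_pos hβ0 _
  have hcube : (2 * Real.sqrt N * m₀) ^ 3 ≤ Ca ^ 3 * β ^ (9 * θ + 3 * δ - 3 / 2) := by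
    have h2 := pow_le_pow_left₀ (by positivity) hmle 3
    have e : (Ca * β ^ (3 * θ + δ - 1 / 2)) ^ 3 = Ca ^ 3 * β ^ (9 * θ + 3 * δ - 3 / 2) := by
      rw [mul_pow, show (9 : ℝ) * θ + 3 * δ - 3 / 2 = (3 * θ + δ - 1 / 2) * ((3 : ℕ) : ℝ) by push_cast; ring,
        Real.rpow_mul_natCast hβ0.le]
    rwa [e] at h2
  have hexpB : β ^ (9 * θ + 3 * δ - 3 / 2) = β ^ (9 * θ + δ - 1 / 2) * β ^ (2 * δ - 1) := by
    rw [← Real.rpow_add hβ0]; ring_nf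
  have hrem : 380 * (2 * Real.sqrt N * m₀) ^ 3 ≤ β ^ (2 * δ - 1) := by
    have h1 : 380 * (2 * Real.sqrt N * m₀) ^ 3 ≤ 380 * (Ca ^ 3 * β ^ (9 * θ + 3 * δ - 3 / 2)) := by linarith
    have h2 : 380 * (Ca ^ 3 * β ^ (9 * θ + 3 * δ - 3 / 2)) = (380 * Ca ^ 3 * β ^ (9 * θ + δ - 1 / 2)) * β ^ (2 * δ - 1) := by
      rw [hexpB]; ring
    have h3 : (380 * Ca ^ 3 * β ^ (9 * θ + δ - 1 / 2)) * β ^ (2 * δ - 1) ≤ 1 * β ^ (2 * δ - 1) :=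
      mul_le_mul_of_nonneg_right hC hβpow.le
    linarith
  calc ∑ c : Fin (dimE ρ), formM (fun e => e ∉ dirFreeEdges H) dirCorner (2 * H + 3) (fun e => a e c) (fun e' : DirFree H => a e'.1.1 c)
      ≤ ((plaquettesIn (halfOpenBox 4 (2 * H + 3))).card : ℝ) * (2 * β ^ (2 * δ - 1) + 380 * (2 * Real.sqrt N * m₀) ^ 3) := hE
    _ ≤ (6 * (2 * (H : ℝ) + 3) ^ 4) * (2 * β ^ (2 * δ - 1) + β ^ (2 * δ - 1)) := by
        apply mul_le_mul hP (by linarith) (by positivity) (by positivity)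
    _ = 18 * (2 * (H : ℝ) + 3) ^ 4 * β ^ (2 * δ - 1) := by ring

/-- **The datum package in the `∃ ϑ, ∃ s` shape of the energy clause of `KernelMeanExpansionG` / `KernelCovExpansionG`**, every compact `G`
presented in `U(N)`: for `0 < θ`, `0 ≤ δ`, `9θ + δ < 1/2` there are `Ca, CE > 0`, `β₀` such that for `β ≥ β₀`, `H = ⌈β^θ⌉`, every crude-good
`ω` admits a gauge `g`, a colour-major datum `ϑ : Fin D → edges → ℝ` and competitors `s : Fin D → DirFree H → ℝ` (`s c = ϑ c|_free`) with:
(1) `W e = expChart ρ (c ↦ ϑ c e)` for every edge (`W` the forest-gauged truncated gauge copy); (2) `Σ_c (ϑ c e)² ≤ Ca²·β^{6θ+2δ−1}` for every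
edge; (3) `ϑ c (x, e₀) = 0` on the temporal forest; (4) `Σ_c M_{ϑ_c}(s_c) ≤ CE(2H+3)⁴β^{2δ−1}`. -/
theorem exists_datum_packageG (hρ : Continuous ρ) (hinj : Function.Injective ρ)
    (hρu : ∀ g, ρ g ∈ Matrix.unitaryGroup (Fin N) ℂ) {θ δ : ℝ} (hθ : 0 < θ) (hδ : 0 ≤ δ) (hwin : 9 * θ + δ < 1 / 2) :
    ∃ Ca CE : ℝ, 0 < Ca ∧ 0 < CE ∧ ∃ β₀ : ℝ, ∀ β : ℝ, β₀ ≤ β → ∀ ω : LGConfig 4 G, CrudeGoodG ρ β δ ⌈β ^ θ⌉₊ ω →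
      ∃ (g : Site 4 → G) (ϑ : Fin (dimE ρ) → Literature.MathematicalPhysics.QuantumLattice.ZdEdge 4 → ℝ)
        (s : Fin (dimE ρ) → DirFree ⌈β ^ θ⌉₊ → ℝ),
        (∀ e, forestFix ⌈β ^ θ⌉₊ (glueWith (boxEdgesAt dirCorner (2 * ⌈β ^ θ⌉₊ + 3))
            (fun e' : ↥(boxEdgesAt dirCorner (2 * ⌈β ^ θ⌉₊ + 3)) => gaugeTransformZd g ω e'.1) (fun _ => 1)) e =
            expChart ρ (WithLp.toLp 2 fun c => ϑ c e)) ∧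
        (∀ e, ∑ c, ϑ c e ^ 2 ≤ Ca ^ 2 * β ^ (6 * θ + 2 * δ - 1)) ∧
        (∀ x : Site 4, (∀ k : Fin 4, 1 ≤ x k ∧ x k + 1 ≤ 2 * (⌈β ^ θ⌉₊ : ℤ)) → ∀ c, ϑ c (x, 0) = 0) ∧
        (∀ c (e' : DirFree ⌈β ^ θ⌉₊), s c e' = ϑ c e'.1.1) ∧
        ∑ c : Fin (dimE ρ), formM (fun e => e ∉ dirFreeEdges ⌈β ^ θ⌉₊) dirCorner (2 * ⌈β ^ θ⌉₊ + 3) (ϑ c) (s c) ≤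
          CE * (2 * (⌈β ^ θ⌉₊ : ℝ) + 3) ^ 4 * β ^ (2 * δ - 1) := by
  obtain ⟨Ca, CE, hCa, hCE, β₀, h⟩ := exists_datum_chartCoords_energy_eventuallyG ρ hρ hinj hρu hθ hδ hwin
  refine ⟨Ca, CE, hCa, hCE, max β₀ 1, fun β hβ ω hω => ?_⟩
  have hβ1 : (1 : ℝ) ≤ β := (le_max_right _ _).trans hβ
  have hβ0 : 0 < β := by linarith
  obtain ⟨g, a, hW, han, -, hforest, hE⟩ := h β ((le_max_left _ _).trans hβ) ω hω
  refine ⟨g, fun c e => a e c, fun c e' => a e'.1.1 c, fun e => ?_, fun e => ?_, fun x hx c => ?_, fun c e' => rfl, hE⟩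
  · rw [hW e]
  · rw [← norm_sq_eq_sum_sq]
    have h1 := han e
    have h0 : 0 ≤ ‖a e‖ := norm_nonneg _
    have h2 := pow_le_pow_left₀ h0 h1 2
    have e2 : (Ca * β ^ (3 * θ + δ - 1 / 2)) ^ 2 = Ca ^ 2 * β ^ (6 * θ + 2 * δ - 1) := by
      rw [mul_pow, show (6 : ℝ) * θ + 2 * δ - 1 = (3 * θ + δ - 1 / 2) * ((2 : ℕ) : ℝ) by push_cast; ring, Real.rpow_mul_natCast hβ0.le]
    rwa [e2] at h2
  · show a (x, 0) c = 0
    rw [hforest x hx]; rfl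

/-- **Rescaled datum**: the energy clause scales by `κ²` under `ϑ ↦ κ·ϑ`, `s ↦ κ·s` (G-free `formM_smul`), e.g. `κ = 1/√2` for the
Dirichlet-unit convention `β·cost_p ≈ ½|circ t|²`, `t = √β·a = √(2β)·(a/√2)`. -/
theorem sum_formM_smul_chartCoords {D H : ℕ} (κ : ℝ) (ϑ : Fin D → Literature.MathematicalPhysics.QuantumLattice.ZdEdge 4 → ℝ)
    (s : Fin D → DirFree H → ℝ) :
    ∑ c : Fin D, formM (fun e => e ∉ dirFreeEdges H) dirCorner (2 * H + 3) (κ • ϑ c) (κ • s c) =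
      κ ^ 2 * ∑ c : Fin D, formM (fun e => e ∉ dirFreeEdges H) dirCorner (2 * H + 3) (ϑ c) (s c) := by
  rw [Finset.mul_sum]
  exact Finset.sum_congr rfl fun c _ => formM_smul κ (ϑ c) (s c)

end Summit.QuantumFields.YangMills.Theorems.ColdBoxAllGroups

end
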